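import Summits.RiemannHypothesis.RiemannHypothesis.Theses.GroundBarta
import Summits.RiemannHypothesis.RiemannHypothesis.Theorems.GroundBartaPolarPerronFrobeniusParitySign
import HarnessLib

/-!
# Route GroundBarta — RESTATE BODIES in route form and their one-line deciding theorems
(crux `PolarPerronFrobenius`, stmt-RiemannHypothesis-18390; RH-free; no definitions)

`Theorems/GroundBartaPolarPerronFrobeniusParitySign.lean` proved, with the rung `GroundBartaFloor` and the
detector `OddNegativityOffLine` discharged:
(i) `riemannHypothesis_of_cofinal_oneSigned` — cofinal one-signed ground states ⇒ RH, NO parity input;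
(ii) `riemannHypothesis_of_polarPerronFrobenius_of_eventually_le` — crux #3 as filed + the TAIL of #4 ⇒ RH.
This file spells the corresponding item BODIES over Mathlib primitives exactly as the route items do (inline
`C`, `M`, `Q`; `IsWeilTest ↦ ContDiff ∧ HasCompactSupport`; junk-free ground-state clause), so that a planner's
`route edit --restate` can copy them, and proves the deciding theorems as one-liners:

* `riemannHypothesis_of_cofinalGSP_routeForm` — body `CofinalGSP` (= #3 with the even-winning hypothesis
  dropped): the route then needs neither #4 `EvenWinsBeyondArch` nor any parity statement;
* `riemannHypothesis_of_polarPerronFrobenius_of_eventuallyEvenWins_routeForm` — #3 verbatim + body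
  `EventuallyEvenWins` (= #4 weakened from "every window `a > (log 2)/2`" to "every window beyond SOME height").

The translations are definitional (`Iff.rfl` for `Q`/`IsWeilTest`; `isWeilGroundState_iff_forall_eventually_le`
for the ground-state clause).  Prover B, speedrun unit `sr-gb-rung-b` (seat 3).
-/

set_option linter.dupNamespace false

noncomputable section

open Set MeasureTheory Filter Complex
open scoped Real Topology

namespace Summit.RiemannHypothesis.RiemannHypothesis.Theorems.PolarPerronFrobenius

open Literature.NumberTheory.LFunctions
open Summit.RiemannHypothesis.RiemannHypothesis.Theses.GroundBarta

/-- **Deciding theorem for the restate body `CofinalGSP`** (crux #3 without its even-winning hypothesis):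
if beyond every height some window carries a ground state of the full windowed Weil form — junk-free
encoding, `Q` spelled over Mathlib primitives as in the route items — that is real and `≥ 0` a.e. on the
open window, then the Riemann Hypothesis holds (rung 2 and the odd detector are PROVED and consumed inside).
[folklore] -/
theorem riemannHypothesis_of_cofinalGSP_routeForm
    (hGSP :
      let C : (ℝ → ℂ) → ℝ → ℂ := fun g => MeasureTheory.convolution g
        (fun t => (starRingEnd ℂ) (g (-t))) (ContinuousLinearMap.mul ℂ ℂ)
        MeasureTheory.MeasureSpace.volume
      let M : (ℝ → ℂ) → ℂ → ℂ := fun F s => ∫ t : ℝ, F t * Complex.exp ((s - 1 / 2) * t)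
      let Q : (ℝ → ℂ) → ℂ := fun g => M (C g) 0 + M (C g) 1 -
        (∑' n : ℕ, ((ArithmeticFunction.vonMangoldt n : ℝ) : ℂ) / (Real.sqrt n : ℂ) *
          (C g (Real.log n) + C g (-Real.log n))) +
        ((1 / (2 * Real.pi) : ℂ) * (∫ t : ℝ, M (C g) (1 / 2 + t * Complex.I) *
          ((Complex.digamma (1 / 4 + t / 2 * Complex.I)).re : ℂ)) - C g 0 * (Real.log Real.pi : ℂ))
      ∀ A : ℝ, ∃ a : ℝ, A ≤ a ∧
        ∃ u : ℝ → ℂ, (MeasureTheory.MemLp u 2 ∧ ∃ g : ℕ → ℝ → ℂ,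
            (∀ n, (ContDiff ℝ ((⊤ : ℕ∞) : WithTop ℕ∞) (g n) ∧ HasCompactSupport (g n)) ∧
              tsupport (g n) ⊆ Set.Icc (-a) a ∧ ∫ t, ‖g n t‖ ^ 2 = (1 : ℝ)) ∧
            (∀ h : ℝ → ℂ, (ContDiff ℝ ((⊤ : ℕ∞) : WithTop ℕ∞) h ∧ HasCompactSupport h) →
              tsupport h ⊆ Set.Icc (-a) a → ∫ t, ‖h t‖ ^ 2 = (1 : ℝ) → ∀ δ : ℝ, 0 < δ →
                ∀ᶠ n in Filter.atTop, (Q (g n)).re ≤ (Q h).re + δ) ∧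
            Filter.Tendsto (fun n => ∫ t, ‖g n t - u t‖ ^ 2) Filter.atTop (nhds 0)) ∧
          (∀ᵐ t : ℝ, t ∈ Set.Ioo (-a) a → (u t).im = 0 ∧ 0 ≤ (u t).re)) :
    RiemannHypothesis :=
  riemannHypothesis_of_cofinal_oneSigned_inline hGSP

/-- **Deciding theorem for #3 verbatim + the restate body `EventuallyEvenWins`** (rung 4 weakened to its
tail: beyond SOME height every odd normalised window test is matched up to any `δ > 0` by an even one).
[folklore] -/
theorem riemannHypothesis_of_polarPerronFrobenius_of_eventuallyEvenWins_routeForm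
    (hPF : PolarPerronFrobenius)
    (hTail :
      let C : (ℝ → ℂ) → ℝ → ℂ := fun g => MeasureTheory.convolution g
        (fun t => (starRingEnd ℂ) (g (-t))) (ContinuousLinearMap.mul ℂ ℂ)
        MeasureTheory.MeasureSpace.volume
      let M : (ℝ → ℂ) → ℂ → ℂ := fun F s => ∫ t : ℝ, F t * Complex.exp ((s - 1 / 2) * t)
      let Q : (ℝ → ℂ) → ℂ := fun g => M (C g) 0 + M (C g) 1 -
        (∑' n : ℕ, ((ArithmeticFunction.vonMangoldt n : ℝ) : ℂ) / (Real.sqrt n : ℂ) *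
          (C g (Real.log n) + C g (-Real.log n))) +
        ((1 / (2 * Real.pi) : ℂ) * (∫ t : ℝ, M (C g) (1 / 2 + t * Complex.I) *
          ((Complex.digamma (1 / 4 + t / 2 * Complex.I)).re : ℂ)) - C g 0 * (Real.log Real.pi : ℂ))
      ∃ A : ℝ, ∀ a : ℝ, A ≤ a → ∀ o : ℝ → ℂ, (ContDiff ℝ ((⊤ : ℕ∞) : WithTop ℕ∞) o ∧ HasCompactSupport o) →
        tsupport o ⊆ Set.Icc (-a) a → (∀ t, o (-t) = -o t) → ∫ t, ‖o t‖ ^ 2 = (1 : ℝ) →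
        ∀ δ : ℝ, 0 < δ → ∃ e : ℝ → ℂ, (ContDiff ℝ ((⊤ : ℕ∞) : WithTop ℕ∞) e ∧ HasCompactSupport e) ∧
          tsupport e ⊆ Set.Icc (-a) a ∧ (∀ t, e (-t) = e t) ∧ ∫ t, ‖e t‖ ^ 2 = (1 : ℝ) ∧
          (Q e).re ≤ (Q o).re + δ) :
    RiemannHypothesis := by
  obtain ⟨A, hA⟩ := hTail
  refine riemannHypothesis_of_polarPerronFrobenius_of_eventually_le hPF ?_
  filter_upwards [eventually_ge_atTop (max A 1)] with a ha
  have ha0 : 0 < a := lt_of_lt_of_le one_pos ((le_max_right A 1).trans ha)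
  exact weilEvenGroundEnergy_le_weilOddGroundEnergy_of_evenWinsAt ha0 (hA a ((le_max_left A 1).trans ha))

end Summit.RiemannHypothesis.RiemannHypothesis.Theorems.PolarPerronFrobenius

end
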